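import Mathlib
import HarnessLib
import Summits.Ventures.LatticeQCDFlow.Scoring.ChainEDFBand

/-!
# An HONEST SIMULTANEOUS CONFIDENCE BAND for the printed distribution function of a statistic
# along a Doeblin chain, from any start: with probability at least `1 − α` the whole empirical
# distribution function of the first `N` states lies within
# `r_N(α) = 1/N + 8/(εN) + √(32·log(2(N+1)/α)/(ε²N))` of `F_π`, uniformly in `t`

HONEST FRAMING: exact (Metropolis-corrected) sampling algorithms for lattice gauge theory;
figures of merit are autocorrelation/cost numbers at stated couplings and volumes; no
continuum-physics claim.

Venture `LatticeQCDFlow` (cell pub-lqcd), topic `Scoring`; FANOUT row 4 (`s0-u1-b`, rung S0-B).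
`Scoring/ChainEDFBand.chain_measureReal_exists_edf_dev_ge_le` bounds the probability of a
deviation `δ + 1/K` of the chain's empirical distribution function by
`2(K + 1)·exp(−(Nδ − 8/ε)²/(32N/ε²))`.  This file inverts it into the form a card prints — a
radius at confidence level `1 − α` — exactly as `Scoring/ChainConfidenceInterval` did for time
averages: with the grid size `K = N` and
`δ = 8/(εN) + √(32·log(2(N+1)/α)/(ε²N))` the exponent equals `log(2(N+1)/α)` and the bound
collapses to `α`.  **`chain_edf_confidenceBand`**: `π` invariant for `κ`, `κ(x, ·) ≥ ε π`, `O` a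
measurable real statistic, `N ≠ 0`, `0 < α ≤ 1`; from ANY initial law,
`P_{μ₀}(∃ t, r_N(α) ≤ |F_π(t) − F̂_N(t)|) ≤ α`.  The radius is `O(√(log N / N)/ε)`: a Doeblin
certificate alone prices a Kolmogorov–Smirnov-type band for MCMC output, no stationarity, no
thinning, no autocorrelation estimate.  **`indepMH_edf_confidenceBand`**: the exact flow sampler
`indepMH q w` under a weight ceiling `w ≤ M` (`ε = 1/M`).  NEW WORK of the cell (not a published
result); no definition is introduced.

Read through the symmetric Galois-connection lemma `QuantileBand.quantile_bracket_of_abs_cdf_sub_lt`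
(empirical measure versus stationary law), the same band is an HONEST SIMULTANEOUS CONFIDENCE
STATEMENT FOR THE WHOLE PERCENTILE TABLE of one run: **`chain_quantile_confidenceBracket`** —
`P_{μ₀}(∃ u ∈ (r, 1 − r), ¬(q̂_N(u − r) ≤ q_π(u) ≤ q̂_N(u + r))) ≤ α`, `r = r_N(α)`: every stationary
quantile is bracketed by printed empirical quantiles at shifted levels, with no density, no
autocorrelation time and no second run (the estimator-free substitute for the studentised MCMC
quantile interval); **`indepMH_quantile_confidenceBracket`** for the exact flow sampler.

## Content

* `bandRadius_exponent_eq` — the algebra `(Nδ − 8/ε)²/(32N/ε²) = log(2(N+1)/α)`;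
* **`chain_edf_confidenceBand`**, **`indepMH_edf_confidenceBand`**;
* **`chain_quantile_confidenceBracket`**, **`indepMH_quantile_confidenceBracket`**.

NOT CLAIMED: optimality of the radius (the DKW rate without the `log N` is not claimed for chains
here); the bracket's length in the VALUE scale (needs local growth of `F_π`); any `ε` for a
concrete sampler; the block-certificate version (same inversion on `Scoring/ChainEDFBandSkeleton`).
-/

noncomputable section

namespace Summit.Ventures.LatticeQCDFlow.Scoring.GlivenkoCantelli

open MeasureTheory ProbabilityTheory Finset Filter Function
open scoped Topology ENNReal

/-- The algebra of the inversion: with `s = √(32L/(e²N))` and `δ = 8/(eN) + s` (`e, N > 0`,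
`L ≥ 0`): `(Nδ − 8/e)²/(32N/e²) = L`. [ours] -/
theorem bandRadius_exponent_eq {e L : ℝ} {N : ℕ} (he : 0 < e) (hN : N ≠ 0) (hL : 0 ≤ L) :
    ((N : ℝ) * (8 / (e * N) + Real.sqrt (32 * L / (e ^ 2 * N))) - 8 / e) ^ 2 / (32 * N / e ^ 2)
      = L := by
  have hNpos : (0 : ℝ) < N := by exact_mod_cast Nat.pos_of_ne_zero hN
  have h1 : (N : ℝ) * (8 / (e * N) + Real.sqrt (32 * L / (e ^ 2 * N))) - 8 / e
      = N * Real.sqrt (32 * L / (e ^ 2 * N)) := by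
    field_simp
    ring
  rw [h1, mul_pow, Real.sq_sqrt (by positivity)]
  field_simp

variable {Ω : Type*} [MeasurableSpace Ω]
variable {κ : Kernel Ω Ω} [IsMarkovKernel κ] {μ₀ : Measure Ω} [IsProbabilityMeasure μ₀]
  {π : Measure Ω} [IsProbabilityMeasure π]

/-- **THE SIMULTANEOUS CONFIDENCE BAND FOR THE PRINTED DISTRIBUTION FUNCTION OF A DOEBLIN CHAIN,
FROM ANY START.**  `π` invariant for `κ`, `κ(x, ·) ≥ ε π` (`ε > 0`), `O` a measurable real
statistic, `F_π = cdf (π ∘ O⁻¹)`; `N ≠ 0`, `0 < α ≤ 1`.  Then with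
`r = 8/(εN) + √(32·log(2(N+1)/α)/(ε²N)) + 1/N`, for every initial law `μ₀`:
`P_{μ₀}(∃ t, r ≤ |F_π(t) − #{i<N : O(X_i) ≤ t}/N|) ≤ α`. [ours] -/
theorem chain_edf_confidenceBand (hπ : Kernel.Invariant κ π) {ε : ℝ≥0∞}
    (hmin : ∀ x {B : Set Ω}, MeasurableSet B → ε * π B ≤ κ x B) (hε0 : 0 < ε)
    {O : Ω → ℝ} (hO : Measurable O) {N : ℕ} (hN : N ≠ 0) {α : ℝ} (hα0 : 0 < α) (hα1 : α ≤ 1) :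
    (Kernel.trajMeasure (X := fun _ : ℕ => Ω) μ₀
          (fun m : ℕ => κ.comap (fun y : (i : ↥(Finset.Iic m)) → Ω => y ⟨m, Finset.mem_Iic.2 le_rfl⟩)
            (measurable_pi_apply _))).real
        {x | ∃ t : ℝ, (8 / (ε.toReal * N)
              + Real.sqrt (32 * Real.log (2 * ((N : ℝ) + 1) / α) / (ε.toReal ^ 2 * N))) + 1 / N
            ≤ |cdf (π.map O) t
              - (∑ i ∈ range N, (Set.Iic t).indicator (1 : ℝ → ℝ) (O (x i))) / N|}
      ≤ α := by
  obtain ⟨-, -, -, -, -, he⟩ := half_const_bounds hmin hε0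
  set e : ℝ := ε.toReal with hedef
  set L : ℝ := Real.log (2 * ((N : ℝ) + 1) / α) with hL
  have hNpos : (0 : ℝ) < N := by exact_mod_cast Nat.pos_of_ne_zero hN
  have hN1 : 1 ≤ N := Nat.one_le_iff_ne_zero.2 hN
  have hq : 0 < 2 * ((N : ℝ) + 1) / α := by positivity
  have hL0 : 0 ≤ L := Real.log_nonneg (by
    rw [le_div_iff₀ hα0]
    nlinarith)
  set δ : ℝ := 8 / (e * N) + Real.sqrt (32 * L / (e ^ 2 * N)) with hδdef
  have hδ0 : 0 < δ := by positivity
  have hδN : 8 / e ≤ N * δ := by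
    rw [hδdef, mul_add]
    have h1 : (N : ℝ) * (8 / (e * N)) = 8 / e := by field_simp
    rw [h1]
    have : 0 ≤ (N : ℝ) * Real.sqrt (32 * L / (e ^ 2 * N)) := by positivity
    linarith
  have hband := chain_measureReal_exists_edf_dev_ge_le (μ₀ := μ₀) hπ hmin hε0 hO hN1 hN hδ0 hδN
  rw [← hedef] at hband
  have hexp : Real.exp (-(N * δ - 8 / e) ^ 2 / (32 * N / e ^ 2)) = α / (2 * ((N : ℝ) + 1)) := by
    rw [hδdef, neg_div, bandRadius_exponent_eq he hN hL0, hL, Real.exp_neg, Real.exp_log hq,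
      inv_div]
  rw [hexp] at hband
  have hfin : 2 * ((N : ℝ) + 1) * (α / (2 * ((N : ℝ) + 1))) = α := by
    field_simp
  rw [hfin] at hband
  exact hband

section FlowSampler

open Summit.Ventures.LatticeQCDFlow.Exactness

/-- **THE CONFIDENCE BAND FOR AN EXACT FLOW SAMPLER.**  Model law `q` (the flow's output), weight
`w = dπ/dq` measurable with `0 < w ≤ M`, `π = w · q` a probability law, `K = indepMH q w` (exact,
Doeblin with `ε = 1/M`); `O` measurable, `N ≠ 0`, `0 < α ≤ 1`.  Then from any initial law, with
`r = 8M/N + M·√(32·log(2(N+1)/α)/N) + 1/N`: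
`P_{μ₀}(∃ t, r ≤ |F_π(t) − F̂_N(t)|) ≤ α`. [ours] -/
theorem indepMH_edf_confidenceBand {q : Measure Ω} [IsProbabilityMeasure q] {w : Ω → ℝ}
    [hwF : Fact (Measurable w)] (hw0 : ∀ x, 0 < w x) {M : ℝ} (hM : ∀ x, w x ≤ M)
    [IsProbabilityMeasure (q.withDensity fun y => ENNReal.ofReal (w y))]
    {O : Ω → ℝ} (hO : Measurable O) {N : ℕ} (hN : N ≠ 0) {α : ℝ} (hα0 : 0 < α) (hα1 : α ≤ 1) :
    (Kernel.trajMeasure (X := fun _ : ℕ => Ω) μ₀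
          (fun m : ℕ => (indepMH q w).comap
            (fun y : (i : ↥(Finset.Iic m)) → Ω => y ⟨m, Finset.mem_Iic.2 le_rfl⟩)
            (measurable_pi_apply _))).real
        {x | ∃ t : ℝ, (8 * M / N + M * Real.sqrt (32 * Real.log (2 * ((N : ℝ) + 1) / α) / N))
              + 1 / N
            ≤ |cdf ((q.withDensity fun y => ENNReal.ofReal (w y)).map O) t
              - (∑ i ∈ range N, (Set.Iic t).indicator (1 : ℝ → ℝ) (O (x i))) / N|}
      ≤ α := by
  have hw : Measurable w := hwF.out
  obtain ⟨x0⟩ := nonempty_of_isProbabilityMeasure q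
  have hM0 : 0 < M := (hw0 x0).trans_le (hM x0)
  have hinv := indepMH_invariant (q := q) hw hw0
  have hmin : ∀ x {B : Set Ω}, MeasurableSet B →
      (ENNReal.ofReal M)⁻¹ * (q.withDensity fun y => ENNReal.ofReal (w y)) B
        ≤ indepMH q w x B :=
    fun x B hB => indepMH_apply_ge (q := q) hw hw0 hM x hB
  have hε0 : 0 < (ENNReal.ofReal M)⁻¹ := ENNReal.inv_pos.2 ENNReal.ofReal_ne_top
  have hε : ((ENNReal.ofReal M)⁻¹).toReal = M⁻¹ := by
    rw [ENNReal.toReal_inv, ENNReal.toReal_ofReal hM0.le]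
  have h := chain_edf_confidenceBand (μ₀ := μ₀) hinv hmin hε0 hO hN hα0 hα1
  rw [hε] at h
  have hNpos : (0 : ℝ) < N := by exact_mod_cast Nat.pos_of_ne_zero hN
  have e1 : (8 : ℝ) / (M⁻¹ * N) = 8 * M / N := by
    field_simp
  have e2 : Real.sqrt (32 * Real.log (2 * ((N : ℝ) + 1) / α) / (M⁻¹ ^ 2 * N))
      = M * Real.sqrt (32 * Real.log (2 * ((N : ℝ) + 1) / α) / N) := by
    have : 32 * Real.log (2 * ((N : ℝ) + 1) / α) / (M⁻¹ ^ 2 * N)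
        = M ^ 2 * (32 * Real.log (2 * ((N : ℝ) + 1) / α) / N) := by
      field_simp
    rw [this, Real.sqrt_mul (sq_nonneg M), Real.sqrt_sq hM0.le]
  rw [e1, e2] at h
  exact h

end FlowSampler

/-! ## The percentile table as a simultaneous confidence statement -/

section Quantiles

/-- **ALL STATIONARY QUANTILES BRACKETED BY PRINTED EMPIRICAL QUANTILES, LEVEL `1 − α`, ANY
START.**  `π` invariant for `κ`, `κ(x, ·) ≥ ε π` (`ε > 0`), `O` a measurable real statistic,
`q_π(v) = inf{x : v ≤ F_π(x)}`, `q̂_N(v) = inf{x : v ≤ cdf(N⁻¹Σ_{i<N} δ_{O(X_i)}) x}`; `N ≠ 0`,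
`0 < α ≤ 1`, `r = 8/(εN) + √(32·log(2(N+1)/α)/(ε²N)) + 1/N`.  Then
`P_{μ₀}(∃ u, r < u ∧ u + r < 1 ∧ ¬(q̂_N(u − r) ≤ q_π(u) ≤ q̂_N(u + r))) ≤ α`. [ours] -/
theorem chain_quantile_confidenceBracket (hπ : Kernel.Invariant κ π) {ε : ℝ≥0∞}
    (hmin : ∀ x {B : Set Ω}, MeasurableSet B → ε * π B ≤ κ x B) (hε0 : 0 < ε)
    {O : Ω → ℝ} (hO : Measurable O) {N : ℕ} (hN : N ≠ 0) {α : ℝ} (hα0 : 0 < α) (hα1 : α ≤ 1) :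
    (Kernel.trajMeasure (X := fun _ : ℕ => Ω) μ₀
          (fun m : ℕ => κ.comap (fun y : (i : ↥(Finset.Iic m)) → Ω => y ⟨m, Finset.mem_Iic.2 le_rfl⟩)
            (measurable_pi_apply _))).real
        {x | ∃ u : ℝ, (8 / (ε.toReal * N)
              + Real.sqrt (32 * Real.log (2 * ((N : ℝ) + 1) / α) / (ε.toReal ^ 2 * N))) + 1 / N < u
          ∧ u + ((8 / (ε.toReal * N)
              + Real.sqrt (32 * Real.log (2 * ((N : ℝ) + 1) / α) / (ε.toReal ^ 2 * N))) + 1 / N) < 1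
          ∧ ¬ (sInf {y | u - ((8 / (ε.toReal * N)
                  + Real.sqrt (32 * Real.log (2 * ((N : ℝ) + 1) / α) / (ε.toReal ^ 2 * N))) + 1 / N)
                ≤ cdf (((N : ℝ≥0∞)⁻¹) • ∑ i ∈ range N, Measure.dirac (O (x i))) y}
                ≤ sInf {y | u ≤ cdf (π.map O) y}
              ∧ sInf {y | u ≤ cdf (π.map O) y}
                ≤ sInf {y | u + ((8 / (ε.toReal * N)
                  + Real.sqrt (32 * Real.log (2 * ((N : ℝ) + 1) / α) / (ε.toReal ^ 2 * N))) + 1 / N)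
                ≤ cdf (((N : ℝ≥0∞)⁻¹) • ∑ i ∈ range N, Measure.dirac (O (x i))) y})}
      ≤ α := by
  haveI : IsProbabilityMeasure (π.map O) := Measure.isProbabilityMeasure_map hO.aemeasurable
  obtain ⟨-, -, -, -, -, he⟩ := half_const_bounds hmin hε0
  have hN1 : 1 ≤ N := Nat.one_le_iff_ne_zero.2 hN
  have hr : 0 < (8 / (ε.toReal * N)
      + Real.sqrt (32 * Real.log (2 * ((N : ℝ) + 1) / α) / (ε.toReal ^ 2 * N))) + 1 / N := by
    positivity
  refine le_trans (measureReal_mono ?_ (measure_ne_top _ _))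
    (chain_edf_confidenceBand (μ₀ := μ₀) hπ hmin hε0 hO hN hα0 hα1)
  rintro x ⟨u, hru, hur, hnot⟩
  by_contra hgood
  simp only [Set.mem_setOf_eq, not_exists, not_le] at hgood
  haveI := isProbabilityMeasure_empiricalMeasure (fun i => O (x i)) hN1
  refine hnot (quantile_bracket_of_abs_cdf_sub_lt
    (((N : ℝ≥0∞)⁻¹) • ∑ i ∈ range N, Measure.dirac (O (x i))) (π.map O) hr hru hur fun t => ?_)
  rw [cdf_empiricalMeasure (fun i => O (x i)) hN1 t, abs_sub_comm]
  exact hgood t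

section FlowSamplerQuantiles

open Summit.Ventures.LatticeQCDFlow.Exactness

/-- **THE PERCENTILE TABLE OF AN EXACT FLOW SAMPLER IS AN HONEST CONFIDENCE STATEMENT.**  Model
law `q`, weight `w = dπ/dq` measurable with `0 < w ≤ M`, `π = w · q` a probability law,
`K = indepMH q w`; `O` measurable, `N ≠ 0`, `0 < α ≤ 1`,
`r = 8M/N + M·√(32·log(2(N+1)/α)/N) + 1/N`.  Then from any initial law,
`P_{μ₀}(∃ u, r < u ∧ u + r < 1 ∧ ¬(q̂_N(u − r) ≤ q_π(u) ≤ q̂_N(u + r))) ≤ α`. [ours] -/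
theorem indepMH_quantile_confidenceBracket {q : Measure Ω} [IsProbabilityMeasure q] {w : Ω → ℝ}
    [hwF : Fact (Measurable w)] (hw0 : ∀ x, 0 < w x) {M : ℝ} (hM : ∀ x, w x ≤ M)
    [IsProbabilityMeasure (q.withDensity fun y => ENNReal.ofReal (w y))]
    {O : Ω → ℝ} (hO : Measurable O) {N : ℕ} (hN : N ≠ 0) {α : ℝ} (hα0 : 0 < α) (hα1 : α ≤ 1) :
    (Kernel.trajMeasure (X := fun _ : ℕ => Ω) μ₀
          (fun m : ℕ => (indepMH q w).comap
            (fun y : (i : ↥(Finset.Iic m)) → Ω => y ⟨m, Finset.mem_Iic.2 le_rfl⟩)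
            (measurable_pi_apply _))).real
        {x | ∃ u : ℝ, (8 * M / N + M * Real.sqrt (32 * Real.log (2 * ((N : ℝ) + 1) / α) / N))
              + 1 / N < u
          ∧ u + ((8 * M / N + M * Real.sqrt (32 * Real.log (2 * ((N : ℝ) + 1) / α) / N)) + 1 / N)
              < 1
          ∧ ¬ (sInf {y | u - ((8 * M / N
                  + M * Real.sqrt (32 * Real.log (2 * ((N : ℝ) + 1) / α) / N)) + 1 / N)
                ≤ cdf (((N : ℝ≥0∞)⁻¹) • ∑ i ∈ range N, Measure.dirac (O (x i))) y}
                ≤ sInf {y | u ≤ cdf ((q.withDensity fun y => ENNReal.ofReal (w y)).map O) y}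
              ∧ sInf {y | u ≤ cdf ((q.withDensity fun y => ENNReal.ofReal (w y)).map O) y}
                ≤ sInf {y | u + ((8 * M / N
                  + M * Real.sqrt (32 * Real.log (2 * ((N : ℝ) + 1) / α) / N)) + 1 / N)
                ≤ cdf (((N : ℝ≥0∞)⁻¹) • ∑ i ∈ range N, Measure.dirac (O (x i))) y})}
      ≤ α := by
  have hw : Measurable w := hwF.out
  obtain ⟨x0⟩ := nonempty_of_isProbabilityMeasure q
  have hM0 : 0 < M := (hw0 x0).trans_le (hM x0)
  have hinv := indepMH_invariant (q := q) hw hw0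
  have hmin : ∀ x {B : Set Ω}, MeasurableSet B →
      (ENNReal.ofReal M)⁻¹ * (q.withDensity fun y => ENNReal.ofReal (w y)) B
        ≤ indepMH q w x B :=
    fun x B hB => indepMH_apply_ge (q := q) hw hw0 hM x hB
  have hε0 : 0 < (ENNReal.ofReal M)⁻¹ := ENNReal.inv_pos.2 ENNReal.ofReal_ne_top
  have hε : ((ENNReal.ofReal M)⁻¹).toReal = M⁻¹ := by
    rw [ENNReal.toReal_inv, ENNReal.toReal_ofReal hM0.le]
  have h := chain_quantile_confidenceBracket (μ₀ := μ₀) hinv hmin hε0 hO hN hα0 hα1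
  rw [hε] at h
  have hNpos : (0 : ℝ) < N := by exact_mod_cast Nat.pos_of_ne_zero hN
  have e1 : (8 : ℝ) / (M⁻¹ * N) = 8 * M / N := by
    field_simp
  have e2 : Real.sqrt (32 * Real.log (2 * ((N : ℝ) + 1) / α) / (M⁻¹ ^ 2 * N))
      = M * Real.sqrt (32 * Real.log (2 * ((N : ℝ) + 1) / α) / N) := by
    have : 32 * Real.log (2 * ((N : ℝ) + 1) / α) / (M⁻¹ ^ 2 * N)
        = M ^ 2 * (32 * Real.log (2 * ((N : ℝ) + 1) / α) / N) := by
      field_simp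
    rw [this, Real.sqrt_mul (sq_nonneg M), Real.sqrt_sq hM0.le]
  rw [e1, e2] at h
  exact h

end FlowSamplerQuantiles

end Quantiles

end Summit.Ventures.LatticeQCDFlow.Scoring.GlivenkoCantelli

end
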